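import Summits.BirchSwinnertonDyer.BirchSwinnertonDyer.Theorems.SignedLowerHalvesKobayashiMainConjectureSmallImageOneSignSwap
import HarnessLib

/-!
# Crux idea `cm-anchor-onesign` (item stmt-BirchSwinnertonDyer-19002, `KobayashiMainConjectureSmallImage`) —
# FIRST RUNG CLOSED: `SwapStatement` and `OneSignCmRoad` of the ideator's sketch (sha16 8432f411d41e258f,
# `pub/ideators/bsd-idea-13/sketches/cm-anchor-onesign-Sketch.lean`, item evidence) PROVED.

Seat bsd-line-slh-p3 gen 4 (prover, LINE lead on crux 19002, line birth b1bf5b11). The two `def … : Prop` below are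
copied VERBATIM from the sketch; the two `_holds` theorems are one-liners from the landed helper file
`Theorems/SignedLowerHalvesKobayashiMainConjectureSmallImageOneSignSwap.lean` (p614662, commit 482c4cfaacba):
`hasUnitContent_of_mazurTate_congr_swap` and `exists_kobayashiMainConjecture_of_oneSign_of_cmPartner`.
This answers the card's «Cheapest falsifier (1)» (critic VERDICT #9): the swap is TRUE as typed (the `C(p)·r`
shape survives multiplication by `−c⁻¹`), and the one-sign CM road composes as claimed. EVIDENCE FILE (crux
workfile / item evidence), not a Theorems proposal: it declares `def`s. Nothing about any curve is asserted; the
crux stays OPEN; BSD is not proved by any of this.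
-/

set_option autoImplicit false
set_option linter.dupNamespace false
noncomputable section

open scoped Classical MatrixGroups ModularForm BigOperators

open CongruenceSubgroup WeierstrassCurve NumberField IsDedekindDomain
  Literature.NumberTheory.EllipticCurves
  Literature.NumberTheory.EllipticCurves.ModularForms
  Literature.NumberTheory.EllipticCurves.Rank1Residual
  Literature.NumberTheory.EllipticCurves.Rank1Residual.Typed
  Literature.NumberTheory.EllipticCurves.Kobayashi2003 ZpExtension
  Literature.NumberTheory.EllipticCurves.GreenbergVatsal2000
  Literature.NumberTheory.EllipticCurves.BDKim2009
  Literature.NumberTheory.EllipticCurves.Sprung2017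
  Summit.BirchSwinnertonDyer.Rank1Residual.X1.MuLambda
  Summit.BirchSwinnertonDyer.Rank1Residual.X11a
  Summit.BirchSwinnertonDyer.Rank1Residual.Supersingular
  Summit.BirchSwinnertonDyer.BirchSwinnertonDyer.Theorems.SmallImageAnalyticTransfer
  Summit.BirchSwinnertonDyer.BirchSwinnertonDyer.Theorems.SmallImageAnalyticTransferRoad
  Summit.BirchSwinnertonDyer.BirchSwinnertonDyer.Theorems.SmallImageOneSignSwap

namespace Summit.BirchSwinnertonDyer.BirchSwinnertonDyer.Cruxes.KobayashiMainConjectureSmallImage.CmAnchorOneSign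

/-- **SWAP LEMMA (first checkable statement; size S, pure algebra over the tree).** Under the displayed
`S₀`-depleted Mazur–Tate congruence with a unit `c` (verbatim the `hMT` shape of the analytic-transfer road),
unit content of Kobayashi's `L^ε_p` passes FROM `E = W` TO the partner `E′ = W′` (the road's
`hasUnitContent_and_lam_add_eq_of_mazurTate_congr` proves the direction `E′ ⇒ E`; the swap is `hMT` multiplied
by `-c⁻¹`). Nothing asserted. -/
def SwapStatement : Prop :=
  ∀ (p : ℕ) [Fact p.Prime] (W W' : WeierstrassCurve ℚ) [W.IsElliptic] [W.IsGloballyMinimal] [W'.IsElliptic]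
    [W'.IsGloballyMinimal],
    p ≠ 2 → W.HasGoodReductionAtPrime p → W.frobeniusTrace p = 0 →
    W'.HasGoodReductionAtPrime p → W'.frobeniusTrace p = 0 →
    ∀ (N N' : ℕ) [NeZero N] [NeZero N'] (f : CuspForm (Gamma0 N) 2) (f' : CuspForm (Gamma0 N') 2),
    IsNewformOf W f → IsNewformOf W' f' →
    ∀ (P P' : IwasawaAlgebra p), HasUnitContent P → HasUnitContent P' →
    ∀ (c : ℤ_[p]), IsUnit c →
    (∀ n : ℕ, ∃ q r : IwasawaAlgebra p,
      ((mazurTateElement f p n).map (algebraMap ℚ ℚ_[p]) : PowerSeries ℚ_[p]) *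
            iwasawaToPowerSeries p P -
          iwasawaToPowerSeries p (PowerSeries.C c) *
            (((mazurTateElement f' p n).map (algebraMap ℚ ℚ_[p]) : PowerSeries ℚ_[p]) *
              iwasawaToPowerSeries p P') =
        iwasawaToPowerSeries p
          (toIwasawa p (cyclotomicOmega p n) * q + PowerSeries.C (p : ℤ_[p]) * r)) →
    ∀ (ε : ℤˣ) (L L' : IwasawaAlgebra p), IsSignedPAdicLFunction f p ε L →
      IsSignedPAdicLFunction f' p ε L' → HasUnitContent L → HasUnitContent L'

/-- **ONE-SIGN CM ROAD (the line's typed first rung over a RATIONAL CM partner; size S–M over the tree).**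
Published inputs BY NAME (Kobayashi 2003 Thm 1.2 / Thm 4.1 rational clause, period-unit pair, B. D. Kim 2009
Cor 2.13 both halves, Pollack–Rubin 2004, modularity); per-datum: `p` odd good with `a_p(E) = 0`, the
conductor-level newform `f₀`, the E-SIDE RIDER `∃ ε₀ L₀, IsSignedPAdicLFunction f₀ p ε₀ L₀ ∧ HasUnitContent L₀`
(output of crux idea `onesign-mu-cuspidal-generation`), a CM partner `W′` (good supersingular at `p`,
`a_p = 0`, `Γ_ℚ`-isomorphic `p`-torsion), a depletion set `S₀ ∌ p`, and the displayed Mazur–Tate congruence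
with a unit `c`. Conclusion: `∃ ε, KobayashiMainConjecture W p ε` — the crux's conclusion shape — with NO
Eisenstein engine (`stub_lowerSmallImage` bypassed) and NO partner-side `μ` hypothesis (want W3 of the cell's
L4-CM line struck for the rider's sign). Proof plan: `SwapStatement` at `ε₀` ⇒ `hμ′` ⇒
`kobayashiMainConjecture_of_mazurTate_congr_of_cmPartner` at `ε₀`. Nothing asserted. -/
def OneSignCmRoad : Prop :=
  Kobayashi2003.thm12_signedSelmerDual_finite_torsion →
  Kobayashi2003.thm41_signedCharIdeal_divisibility →
  realPeriodRat_eq_unit_mul_plusPeriod → realPeriodRat_eq_unit_mul_plusPeriod_three →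
  cor213_signedMu_eq_zero_iff_of_torsionIso →
  BDKim2009.cor213_signedLambda_add_sum_delta_eq_of_torsionIso →
  PollackRubin2004.mainTheorem_signedCharIdeal_eq_of_cm →
  nonempty_modularParametrizationData →
  ∀ (p : ℕ) [Fact p.Prime] (W : WeierstrassCurve ℚ) [W.IsElliptic] [W.IsGloballyMinimal],
    p ≠ 2 → W.HasGoodReductionAtPrime p → W.frobeniusTrace p = 0 →
    ∀ [NeZero (W.conductorNorm ℤ)] (f₀ : CuspForm (Gamma0 (W.conductorNorm ℤ)) 2), IsNewformOf W f₀ →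
    (∃ (ε₀ : ℤˣ) (L₀ : IwasawaAlgebra p), IsSignedPAdicLFunction f₀ p ε₀ L₀ ∧ HasUnitContent L₀) →
    ∀ (W' : WeierstrassCurve ℚ) [W'.IsElliptic] [W'.IsGloballyMinimal],
    W'.HasCM → GoodSS W' p → W'.frobeniusTrace p = 0 →
    (∃ e : geomTorsion W (p : ℤ) ≃+ geomTorsion W' (p : ℤ),
      ∀ (σ : Field.absoluteGaloisGroup ℚ) (P : geomTorsion W (p : ℤ)), e (σ • P) = σ • e P) →
    ∀ [NeZero (W'.conductorNorm ℤ)] (f₀' : CuspForm (Gamma0 (W'.conductorNorm ℤ)) 2), IsNewformOf W' f₀' →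
    ∀ (S₀ : Finset (HeightOneSpectrum (𝓞 ℚ))), (∀ v ∈ S₀, ((p : ℕ) : 𝓞 ℚ) ∉ v.asIdeal) →
    (∀ v : HeightOneSpectrum (𝓞 ℚ), ¬ W.HasGoodReductionAt v → v ∈ S₀) →
    (∀ v : HeightOneSpectrum (𝓞 ℚ), ¬ W'.HasGoodReductionAt v → v ∈ S₀) →
    ∀ (c : ℤ_[p]), IsUnit c →
    (∀ n : ℕ, ∃ q r : IwasawaAlgebra p,
      ((mazurTateElement f₀ p n).map (algebraMap ℚ ℚ_[p]) : PowerSeries ℚ_[p]) *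
            iwasawaToPowerSeries p (eulerFactorProduct W p S₀) -
          iwasawaToPowerSeries p (PowerSeries.C c) *
            (((mazurTateElement f₀' p n).map (algebraMap ℚ ℚ_[p]) : PowerSeries ℚ_[p]) *
              iwasawaToPowerSeries p (eulerFactorProduct W' p S₀)) =
        iwasawaToPowerSeries p
          (toIwasawa p (cyclotomicOmega p n) * q + PowerSeries.C (p : ℤ_[p]) * r)) →
    ∃ ε : ℤˣ, KobayashiMainConjecture W p ε

/-- **`SwapStatement` HOLDS** (one-liner from p614662's `hasUnitContent_of_mazurTate_congr_swap`). -/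
theorem swapStatement_holds : SwapStatement :=
  fun p _ W W' _ _ _ _ hp2 hgood hap hgood' hap' N N' _ _ f f' hf hf' P P' hP hP' c hc hMT ε L L' hL hL' hLU =>
    hasUnitContent_of_mazurTate_congr_swap p W W' hp2 hgood hap hgood' hap' N N' f f' hf hf' P P' hP hP' c hc
      hMT ε L L' hL hL' hLU

/-- **`OneSignCmRoad` HOLDS** (one-liner from p614662's `exists_kobayashiMainConjecture_of_oneSign_of_cmPartner`). -/
theorem oneSignCmRoad_holds : OneSignCmRoad :=
  fun h12 h41 h5 h3 h09 hKim hPR hmod p _ W _ _ hp2 hgood hap _ f₀ hf₀ hrider W' _ _ hcm' hss' hap' he _ f₀' hf₀'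
      S₀ hS₀ hS₀W hS₀W' c hc hMT =>
    exists_kobayashiMainConjecture_of_oneSign_of_cmPartner h12 h41 h5 h3 h09 hKim hPR hmod p W hp2 hgood hap f₀
      hf₀ hrider W' hcm' hss' hap' he f₀' hf₀' S₀ hS₀ hS₀W hS₀W' c hc hMT

end Summit.BirchSwinnertonDyer.BirchSwinnertonDyer.Cruxes.KobayashiMainConjectureSmallImage.CmAnchorOneSign

end
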